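import Summits.QuantumFields.YangMills.Theorems.BalabanUVNodesPortS1HalvesDefs
import Summits.QuantumFields.YangMills.Theorems.BalabanUVNodesK0RecordFormatNamesLDress
import Summits.QuantumFields.YangMills.Theorems.BalabanUVNodesPortS1JacPiecesDefs

/-!
# K0⁷ — THE RECORD-SIDE FORMAT NAMES, EDITION 23 = THE P0-ℂ LETTER `P0HolExtAtRecord F` (★★★ director-ym №546 STAGE 1 ∕ №548 (i); ▶ porter PT-A-1 g7's
# `P0C-CONSUMER-SPEC-v1.md` §3 (P1)–(P5), shape (L-∃) «the complex carrier ∃-quantified inside, k-uniform constants first» — consumer's GO nodeO STATUS 2026-08-31T09:56:54Z;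
# v2 = consumer's verdict l.5082 (10:04:22Z) changes (c1) (P5) carries SYMMETRY (`PosDef`), (c2) the cover bridge reaches LOCALIZED INTEGER PIECES `TZY` on `ℤ⁴` with `ℤ⁴`-level support ∕
# window-locality ∕ covariance for ALL integer configurations, (c3) `εbg = a₀` confirmed; v3 = l.5093 (c4) the body is ONE NAMED PREDICATE `P0CarrierClauses`, (c5) + ◆ CRIT-1 g37 l.5096
# QF-1∕QF-2 AS AMENDED l.5100 (composition-checked with `G3CAtRecord` and the glue): the (Q-ord) PREFIX `∃ c₀ γ₀ γ₁, ∀ δ₀ > 0, ∃ Mth, ∀ Mc ≥ Mth, McGuard → ∀ a₀ > 0, ∃ α₀ α₁, ∀ ε₂₉ > 0, ∀ k,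
# ∃ carriers` — constants absolute, rate DEMANDED, threshold answers to the rate alone and precedes `a₀`; v5 = body := ▶ PT-A-1's typed body (l.5109: (c7) (P3) PIECEWISE, (c6a) SCHUR
# decay, (c6b) (P5ᶜ) complex coercivity of the localized partial sums, l.5112 (c8) (Z-dom)) verbatim under that prefix)

Cell `ym-nodeO-ideate` ∕ `ym-balaban-port`, DEFINER seat `ym-nodeO-def-1` (gen 36); `--kind definition --supports stmt-QuantumFields-20541 --as helper`; count-neutral.
[I] = [Balaban1987RG1], [15] = [Balaban1985Variational], [16] = [Balaban1985UV3].

WHY.  ⟨27930⟩'s registered `stub_LZdet` (the `log Z^{(k)}` half of print's (2.12) at the record) needs, beyond ⟨26900⟩'s REAL-analytic germ (P0-ℝ), print's COMPLEX statement — [15] Prop. 9 p.309 «the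
minimising configuration … has an extension to an analytic function of Gᶜ-valued … configurations» read at the (2.11) CARRIER `C*Δ^{(k)}C` with k-UNIFORM bounds (★★★ №547: LOCATED-GENUINE as a record statement;
mechanism portable: lit-balaban `B11Claim309UAnalytic.analyticOnNhd_solA`).  No complex minimiser exists at the record (every carrier — `UkSel`, `recordΔk₁`, `recordAUk`, def-Y's `BgScheme.sol` — is
real∕`SU(2)`-valued), so the letter quantifies the complex carrier EXISTENTIALLY under a consumer-instantiable (Q-ord) prefix (absolute constants `c₀ γ₀ γ₁` first, rate `δ₀` demanded, threshold `Mth(δ₀)`, then `Mc`, then `a₀`, radii, `ε₂₉`,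
`k`, carriers), and lists EXACTLY the consumer's clauses (P1)–(P5):
(P1) a complex, total carrier family `TC n` on the complex pairs `(𝐔, 𝐉)` of each member volume `recordK₀ + n`, localized as `TC n = Σ_Y TY n Y`, and — so that the consumer can build ONE `IntLocalFormula` (ed.13:
ONE total function on `ℤ⁴`-window configurations whose `isLocal` ∕ `isGaugeInv` fields hold for EVERY integer configuration, precedents ✓`ΨjacRaw` ∕ `isLocal_ΨjacRaw` ∕ `isGaugeInv_ΨjacRaw` ∕
`ΨjacRaw_intCubes_pullPair`) — an integer family of LOCALIZED PIECES `TZY X̂ f` on ed.13's integer-bond pairs `IntBondCfg`, indexed by level-`k` integer bonds × colour, with (Z-supp) support in the `L·Mc`-blocks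
of `X̂`, (Z-loc) ed.13's window-locality `IntFormula.IsLocal (L^{k+1}·Mc)` entry by entry, (Z-cov) covariance under ed.13's pulled-back (1.10) action `intGaugeAct û` of EVERY `SL(2,ℂ)`-valued `û` on EVERY `f`
through `3 × 3` bond blocks `AdZ û b` (invertible), and (Z-bridge) OFF THE WRAP CLASS (`Y ∉ recordWrapCtr`), on the integer window of `X̂_K(Y) = intCubes … Y`, `TY n Y φ (π_k bi, a) (π_k bj, a′) =
TZY (intCubes … Y) (pullPair … φ) (bi, a) (bj, a′)` (the bridge is stated ON THE WINDOW: `π_k` is periodic while (Z-supp) keeps one representative copy, and off the wrap class the cover is injective there —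
✓`coverAt_injOn_blockSites_intCubes`); (P2) germ agreement at real points: eventually in `B`, `TC n` at the rooted uncut pair `recordPairJ … B` IS `recordPreckLoc … (portVkAx … B) (hopLinGraph …)` (ed.15e ∕
▶ PT-A-1's letters, `εbg := a₀` = `(thetaFill F a₀ ε₂₉).εbg`, ✓`theta13OfThm1CCMWZB_εbg` — the match with `portLogZLocAt`'s `θ.εbg`, (c3)); (P3) covariance under det-one gauge transformations `Sect2.cAct u`
through a bond-block-diagonal invertible conjugation `AdM n u`, for ALL pairs; (P4) field localisation (`TY n Y` vanishes unless both indices lie in `Y`, reads the pair only on `domSites … Y`), entrywise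
ℂ-analyticity on the record space `recordUc … Y`, and the k-uniform decay `‖TY n Y φ i j‖ ≤ c₀·e^{−δ₀·dj Y}` there (torus level — they transfer along (Z-bridge) on pull-backs, where rows (a)(b) are asked);
(P5) the real-germ letters eventually at `B = 0`: `(recordPreckLoc …).PosDef` (SYMMETRY + positivity — the (63) glue ✓`eventually_phiLZdet_eq_logDet` ∕ ✓`B10LogDet63.matrix63` is keyed on `Matrix.PosDef`, and
symmetry of `recordPreckLoc = C_locᵀ·recordSkBlk·C_loc` is Schwarz for the SELECTOR — P0 content, not provable from ed.15c) and the two-sided spectral bounds `γ₀·|v|² ≤ ⟨v, recordPreckLoc … v⟩ ≤ γ₁·|v|²`.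
(P6) (the walk-representation leaves) is NOT here — it is `stub_G3C`'s letter, stated universally OVER this letter's carrier (№548 (v3.3-B)).

WHAT THIS FILE IS (definitions only; statement-form; ONE NEW name; every earlier object untouched; NO new bookkeeping type — the integer side speaks ed.13's `IntBondCfg ∕ pullPair ∕ intCubes ∕
intGaugeAct ∕ IntFormula.IsLocal` and ▶ PT-A-1's `coverBondAt`, `QuantumLattice.blockMap` verbatim):
* §26g `P0CarrierClauses F a₀ δ₀ c₀ γ₀ γ₁ Mc α₀ α₁ ε₂₉ k TC TY TZY AdM AdZ : Prop` — the BODY: clauses (P1) = (Z-supp)(Z-dom)(Z-loc)(Z-cov)(Z-bridge), (P2), (P3) piecewise, (P4) Schur, (P5), (P5ᶜ) in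
  the record's names (▶ PT-A-1 (c4)(c6)(c7)(c8), his typed bytes verbatim).
* §26g ★ `P0HolExtAtRecord (F : T4Family) : Prop` — the letter := ◆'s (Q-ord) prefix over `∃ TC TY TZY AdM AdZ, P0CarrierClauses …` (the family `F` is an EXPLICIT binder: a record
  PREDICATE in `F`, not a parameterless cited fact — it stays in `Summits/`).

HONEST FRAMING.  A DISPLAYED STATEMENT (Prop-valued, parameterless in its data beyond `F`) — asserted for nothing; its inhabitation is [15] Prop. 9 ∕ Thm 1 (E2) content at the record (L; porter road
№547: record `Regime` instance → `analyticOnNhd_solA` → complex twin of ed.15c∕15e, its localized pieces on `ℤ⁴` windows per print (1.21) «T^{(j+1)} ↗ Z^d»), NOT proved here or anywhere in the tree; the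
∃-carrier is inhabited NOWHERE today; `stub_LZdet`, `stub_G3C` (P6), `stub_FE`, ⟨26900⟩ OPEN; 27930 OPEN (stubs 2∕4 by name); K0ᴬ ∕ K1ᴬ ∕ K3ᴬ OPEN; NODE O not inhabited (0∕1); COUNT 8∕28 · K 1∕4 UNMOVED;
finite `𝕋⁴_{L^K}` at fixed ε — NOT continuum ∕ ℝ⁴ ∕ OS; **the Yang–Mills mass gap (Clay) is NOT proved by any of this.**  No `sorry`, `instance`, `notation`; standard axioms.
-/

noncomputable section

open scoped BigOperators Matrix.Norms.L2Operator Topology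
open Filter

namespace Summit.QuantumFields.YangMills.Theorems.K0RecordFormatNames

open Literature.MathematicalPhysics.QuantumFieldTheory.Balaban1983to89
open Literature.MathematicalPhysics.QuantumFieldTheory.Balaban1983to89.Node00
open Literature.MathematicalPhysics.QuantumFieldTheory.Balaban1983to89.T4Continuum (T4Family)
open Literature.MathematicalPhysics.QuantumLattice (blockMap)
open Summit.QuantumFields.YangMills.Theorems.BalabanUVNodesPortS1 (portVkAx hopLinGraph coverBondAt)

variable (F : T4Family)

/-! ## §26g  The P0-ℂ letter -/

/-- **THE CARRIER CLAUSES `P0CarrierClauses F a₀ δ₀ c₀ γ₀ γ₁ Mc α₀ α₁ ε₂₉ k TC TY TZY AdM AdZ`** (▶ PT-A-1 (c4): the letter's BODY as ONE NAMED PREDICATE, so that `G3CAtRecord` quantifies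
UNIVERSALLY over the same body and the glue unpacks with one `obtain`; ◆ CRIT-1 g37 l.5096: body (P1)(Z-supp)(Z-loc)(Z-cov)(Z-bridge)∕(P2)∕(P3)∕(P4)∕(P5) STAMPED J1′∕J4∕J5′ — the v2 clauses :85–:137
VERBATIM, `θ := thetaFill F a₀ ε₂₉`): (Z-supp) support of the integer pieces in the `L·Mc`-blocks of `X̂` · (Z-dom) the integer pieces vanish unless `X̂` is a non-empty
FACE-CONNECTED cube set (▶ PT-A-1 (c8): pieces are domain-indexed; only the easy direction «ℤ-face-adjacent ⇒ torus-adjacent» is then ever needed) · (Z-loc) `IntFormula.IsLocal (L^{k+1}·Mc)` entry by entry · (Z-cov) blockwise covariance under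
`intGaugeAct û`, all `SL(2,ℂ)`-valued `û`, all `f` · (Z-bridge) window bridge off the wrap class · (P2) germ agreement · (P3) torus covariance PIECEWISE (each `TY n Y`; ▶ PT-A-1 (c7): the residue's
pieces are traces of PRODUCTS of pieces) · (P4) `Σ_Y`, support, `agreeOnSet`, `AnalyticAt ℂ` on `recordUc` + decay `c₀·e^{−δ₀·dj Y}` in SCHUR form (row sums AND column sums; ▶ PT-A-1 (c6a): every
operator-norm use of the pieces otherwise pays the site count per cube, fixed after `δ₀`) · (P5) `PosDef` + two-sided spectral bounds, eventually at `B = 0` · (P5ᶜ) COMPLEX COERCIVITY of the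
`X`-localized partial sums `Σ_{Y ⊆ X} TY n Y φ` (non-b₀ block) at every `φ` of the record space of `X`, on vectors supported on `X` (▶ PT-A-1 (c6b): `G3CAtRecord` is universal over carriers and must
invert `x + T^{(X)}(φ)` at COMPLEX `φ`; supplier-side = [15] Thm 1 (E2)'s lower bound for the X-local operator on `U^c(X, α₀, α₁)`).  Body = ▶ PT-A-1's `P0CG3C-DRAFT-v2.lean` d1675a1e756c8bb0 :27–:104
VERBATIM (= this seat's v2 clauses + the consumer's deltas (c6a)(c6b)(c7)(c8)).  A predicate WITH PARAMETERS — asserts nothing.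
[cite: Balaban1985Variational, Prop. 9 p.309, (117) p.295; Balaban1987RG1, (2.11)–(2.12) pp.267–268, (1.7) p.261, (1.10) p.262, (1.19) p.263, (1.21) p.264; Balaban1985UV3, (63) p.272, (23)–(25) p.262] -/
def P0CarrierClauses (a₀ δ₀ c₀ γ₀ γ₁ : ℝ) (Mc : ℕ) (α₀ α₁ ε₂₉ : ℝ) (k : ℕ)
    (TC : (n : ℕ) → Sect2.CPair (F.P (recordK₀ F Mc k + n)) (MatA 2) →
        FluctIdx F k (recordK₀ F Mc k + n) → FluctIdx F k (recordK₀ F Mc k + n) → ℂ)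
    (TY : (n : ℕ) → (recordDomSys F Mc k (recordK₀ F Mc k + n)).Dom → Sect2.CPair (F.P (recordK₀ F Mc k + n)) (MatA 2) →
        FluctIdx F k (recordK₀ F Mc k + n) → FluctIdx F k (recordK₀ F Mc k + n) → ℂ)
    (TZY : Finset (Fin 4 → ℤ) → IntBondCfg → ((Fin 4 → ℤ) × Fin 4) × Fin 3 → ((Fin 4 → ℤ) × Fin 4) × Fin 3 → ℂ)
    (AdM : (n : ℕ) → (Site (F.P (recordK₀ F Mc k + n)) 0 → (MatA 2)ˣ) →
        Matrix (FluctIdx F k (recordK₀ F Mc k + n)) (FluctIdx F k (recordK₀ F Mc k + n)) ℂ)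
    (AdZ : ((Fin 4 → ℤ) → (MatA 2)ˣ) → (Fin 4 → ℤ) × Fin 4 → Matrix (Fin 3) (Fin 3) ℂ) : Prop :=
  letI θ := thetaFill F a₀ ε₂₉; letI := θ.instVβ₁; letI := θ.instVβ₂; letI := θ.instιβ
  -- (Z-supp)
  (∀ (Xh : Finset (Fin 4 → ℤ)) (f : IntBondCfg) (bi bj : (Fin 4 → ℤ) × Fin 4) (a a' : Fin 3),
    (blockMap (F.L * Mc) bi.1 ∉ Xh ∨ blockMap (F.L * Mc) bj.1 ∉ Xh) → TZY Xh f (bi, a) (bj, a') = 0) ∧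
  -- (Z-dom) the integer pieces are indexed by non-empty face-connected cube sets (zero elsewhere)
  (∀ (Xh : Finset (Fin 4 → ℤ)) (f : IntBondCfg) (i j : ((Fin 4 → ℤ) × Fin 4) × Fin 3),
    ¬ (Xh.Nonempty ∧ B13ScaleTransfer.FaceConnected Xh) → TZY Xh f i j = 0) ∧
  -- (Z-loc)
  (∀ i j : ((Fin 4 → ℤ) × Fin 4) × Fin 3, IntFormula.IsLocal (F.L ^ (k + 1) * Mc) fun Xh f => TZY Xh f i j) ∧
  -- (Z-cov)
  (∀ û : (Fin 4 → ℤ) → (MatA 2)ˣ, (∀ z, û z ∈ (B12RegularSpaces111SpecialUnitary.suModel 2).Gc) →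
    (∀ b : (Fin 4 → ℤ) × Fin 4, IsUnit (AdZ û b)) ∧
    ∀ (Xh : Finset (Fin 4 → ℤ)) (f : IntBondCfg) (bi bj : (Fin 4 → ℤ) × Fin 4),
      (Matrix.of fun a a' : Fin 3 => TZY Xh (intGaugeAct û f) (bi, a) (bj, a')) =
        AdZ û bi * (Matrix.of fun a a' : Fin 3 => TZY Xh f (bi, a) (bj, a')) * (AdZ û bj)⁻¹) ∧
  -- (Z-bridge)
  (∀ (n : ℕ) (Y : (recordDomSys F Mc k (recordK₀ F Mc k + n)).Dom), Y ∉ recordWrapCtr F Mc k (recordK₀ F Mc k + n) →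
    ∀ (φ : Sect2.CPair (F.P (recordK₀ F Mc k + n)) (MatA 2)) (bi bj : (Fin 4 → ℤ) × Fin 4) (a a' : Fin 3),
      blockMap (F.L * Mc) bi.1 ∈ intCubes F Mc k (recordK₀ F Mc k + n) Y → blockMap (F.L * Mc) bj.1 ∈ intCubes F Mc k (recordK₀ F Mc k + n) Y →
      TY n Y φ (coverBondAt (F.P (recordK₀ F Mc k + n)) k bi, a) (coverBondAt (F.P (recordK₀ F Mc k + n)) k bj, a') =
        TZY (intCubes F Mc k (recordK₀ F Mc k + n) Y) (pullPair F (recordK₀ F Mc k + n) φ) (bi, a) (bj, a')) ∧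
  -- (P2) germ agreement at the record's real points, on the non-b₀ index
  (∀ n : ℕ, ∀ᶠ B in 𝓝 (0 : recordW F a₀ ε₂₉ k (recordK₀ F Mc k + n)),
    ∀ i j : NonB0Idx F k (recordK₀ F Mc k + n),
      TC n (recordPairJ F θ k (recordK₀ F Mc k + n) B) i.1 j.1 =
        ((recordPreckLoc F k (recordK₀ F Mc k + n) a₀ (portVkAx F a₀ ε₂₉ k (recordK₀ F Mc k + n) B)
          (hopLinGraph F k (recordK₀ F Mc k + n) (portVkAx F a₀ ε₂₉ k (recordK₀ F Mc k + n) B)) i j : ℝ) : ℂ)) ∧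
  -- (P3) PIECEWISE covariance under the (1.10) action of every units-valued `u`, for ALL pairs; `AdM` invertible and bond-block-diagonal
  (∀ (n : ℕ) (u : Site (F.P (recordK₀ F Mc k + n)) 0 → (MatA 2)ˣ),
    IsUnit (AdM n u) ∧ (∀ i j : FluctIdx F k (recordK₀ F Mc k + n), i.1 ≠ j.1 → AdM n u i j = 0) ∧
    ∀ (Y : (recordDomSys F Mc k (recordK₀ F Mc k + n)).Dom) (φ : Sect2.CPair (F.P (recordK₀ F Mc k + n)) (MatA 2)),
      Matrix.of (TY n Y (Sect2.cAct u φ)) = AdM n u * Matrix.of (TY n Y φ) * (AdM n u)⁻¹) ∧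
  -- (P4) localisation: the total carrier is the sum of the pieces; support; (1.7) locality; analyticity on the record space; SCHUR row∕column decay
  (∀ (n : ℕ) (φ : Sect2.CPair (F.P (recordK₀ F Mc k + n)) (MatA 2)) (i j : FluctIdx F k (recordK₀ F Mc k + n)),
    TC n φ i j = ∑ Y : (recordDomSys F Mc k (recordK₀ F Mc k + n)).Dom, TY n Y φ i j) ∧
  (∀ (n : ℕ) (Y : (recordDomSys F Mc k (recordK₀ F Mc k + n)).Dom) (φ : Sect2.CPair (F.P (recordK₀ F Mc k + n)) (MatA 2))
      (i j : FluctIdx F k (recordK₀ F Mc k + n)),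
    (B15DeterminingSets.embIter k i.1.src ∉ Sect2.domSites (F.P (recordK₀ F Mc k + n)) Mc (k + 1) Y ∨
      B15DeterminingSets.embIter k j.1.src ∉ Sect2.domSites (F.P (recordK₀ F Mc k + n)) Mc (k + 1) Y) → TY n Y φ i j = 0) ∧
  (∀ (n : ℕ) (Y : (recordDomSys F Mc k (recordK₀ F Mc k + n)).Dom) (φ ψ : Sect2.CPair (F.P (recordK₀ F Mc k + n)) (MatA 2)),
    Sect2.agreeOnSet (Sect2.domSites (F.P (recordK₀ F Mc k + n)) Mc (k + 1) Y) φ ψ → TY n Y φ = TY n Y ψ) ∧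
  (∀ (n : ℕ) (Y : (recordDomSys F Mc k (recordK₀ F Mc k + n)).Dom) (φ : Sect2.CPair (F.P (recordK₀ F Mc k + n)) (MatA 2)),
    encodeCfg F (recordK₀ F Mc k + n) φ ∈ recordUc F Mc k α₀ α₁ (recordK₀ F Mc k + n) Y →
      (∀ i j : FluctIdx F k (recordK₀ F Mc k + n),
        AnalyticAt ℂ (fun ψ : Sect2.CPair (F.P (recordK₀ F Mc k + n)) (MatA 2) => TY n Y ψ i j) φ) ∧
      (∀ i : FluctIdx F k (recordK₀ F Mc k + n),
        ∑ j : FluctIdx F k (recordK₀ F Mc k + n), ‖TY n Y φ i j‖ ≤ c₀ * Real.exp (-(δ₀ * (recordDomSys F Mc k (recordK₀ F Mc k + n)).dj Y))) ∧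
      (∀ j : FluctIdx F k (recordK₀ F Mc k + n),
        ∑ i : FluctIdx F k (recordK₀ F Mc k + n), ‖TY n Y φ i j‖ ≤ c₀ * Real.exp (-(δ₀ * (recordDomSys F Mc k (recordK₀ F Mc k + n)).dj Y)))) ∧
  -- (P5) real-germ letters, eventually at B = 0: symmetry + positivity and the two-sided spectral bounds
  (∀ n : ℕ, ∀ᶠ B in 𝓝 (0 : recordW F a₀ ε₂₉ k (recordK₀ F Mc k + n)),
    (recordPreckLoc F k (recordK₀ F Mc k + n) a₀ (portVkAx F a₀ ε₂₉ k (recordK₀ F Mc k + n) B)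
        (hopLinGraph F k (recordK₀ F Mc k + n) (portVkAx F a₀ ε₂₉ k (recordK₀ F Mc k + n) B))).PosDef ∧
    ∀ v : NonB0Idx F k (recordK₀ F Mc k + n) → ℝ,
      γ₀ * dotProduct v v ≤
          dotProduct v (Matrix.mulVec (recordPreckLoc F k (recordK₀ F Mc k + n) a₀ (portVkAx F a₀ ε₂₉ k (recordK₀ F Mc k + n) B)
            (hopLinGraph F k (recordK₀ F Mc k + n) (portVkAx F a₀ ε₂₉ k (recordK₀ F Mc k + n) B))) v) ∧
        dotProduct v (Matrix.mulVec (recordPreckLoc F k (recordK₀ F Mc k + n) a₀ (portVkAx F a₀ ε₂₉ k (recordK₀ F Mc k + n) B)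
            (hopLinGraph F k (recordK₀ F Mc k + n) (portVkAx F a₀ ε₂₉ k (recordK₀ F Mc k + n) B))) v) ≤
          γ₁ * dotProduct v v) ∧
  -- (P5ᶜ) complex coercivity of the X-localized partial sums on the record space of X (non-b₀ block, vectors supported on X)
  (∀ (n : ℕ) (X : (recordDomSys F Mc k (recordK₀ F Mc k + n)).Dom) (φ : Sect2.CPair (F.P (recordK₀ F Mc k + n)) (MatA 2)),
    encodeCfg F (recordK₀ F Mc k + n) φ ∈ recordUc F Mc k α₀ α₁ (recordK₀ F Mc k + n) X →
      ∀ v : NonB0Idx F k (recordK₀ F Mc k + n) → ℂ,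
        (∀ i : NonB0Idx F k (recordK₀ F Mc k + n),
          B15DeterminingSets.embIter k i.1.1.src ∉ Sect2.domSites (F.P (recordK₀ F Mc k + n)) Mc (k + 1) X → v i = 0) →
        γ₀ * (∑ i, ‖v i‖ ^ 2) ≤
          (∑ i, ∑ j, star (v i) *
            (∑ Y ∈ Finset.univ.filter (fun Y : (recordDomSys F Mc k (recordK₀ F Mc k + n)).Dom => Y.1 ⊆ X.1), TY n Y φ i.1 j.1) * v j).re)

/-- ★ **THE P0-ℂ LETTER `P0HolExtAtRecord F`** — [15] Prop. 9's Gᶜ-extension READ AT THE RECORD's (2.11) CARRIER, k-UNIFORM, in ▶ PT-A-1's consumer clauses (P1)–(P5) (`P0C-CONSUMER-SPEC-v1.md` §3 +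
l.5082 (c1)(c2) + l.5093 (c4)(c5)) under ◆ CRIT-1 g37's COMPOSITION-CHECKED (Q-ord) prefix (l.5096 QF-1∕QF-2 as AMENDED l.5100 — checked against the glue's goal ✓`PortRecordLZdetHalf` and ▶ PT-A-1's
`G3CAtRecord` prefix, so that the glue recipe `⟨c₀,γ₀,γ₁⟩ ← hP0C; δG ← hG3C c₀ γ₀ γ₁ (κ*+1); δ₀ := max δG (2κ*+4); Mth₁ ← hP0C δ₀; …; ⟨max Mth₁ Mth₂, …⟩; intro Mc … a₀ …` reads, at each arrow, only what is
bound to its left): **the constants `c₀ γ₀ γ₁` are OUTERMOST — a₀-FREE and δ₀-FREE (print: `γ₀ γ₁` = the (E2) spectral constants of `C*Δ^{(k)}C` at the near-flat rooted germ, M-, k-, a₀-free; `c₀` absolute once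
the demanded rate is at most half the physical one); the DECAY RATE `δ₀` is DEMANDED (universal — print puts the rate in the cube size: [16] p.262 after (25) «κ can be arbitrarily large if M₁ is sufficiently
large», [I] p.263 after (1.18); our `dj` is in cube units); the CUBE THRESHOLD `Mth` answers to `δ₀` (and the absolute constants) ALONE and is bound BEFORE `a₀` (so it instantiates INTO `PortRecordLZdetHalf`'s
`∃ Mth, ∀ Mc ≥ Mth, ∀ … a₀ …`); then `Mc`, then `a₀`, then the radii `α₀ α₁`, `ε₂₉`, `k`, and the carriers `(TC, TY, TZY, AdM, AdZ)` LAST (`TZY ∕ AdZ` volume-free — one integer formula for all member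
volumes)**; the body is `P0CarrierClauses` (above), the SAME `δ₀` feeding (P4)'s `c₀·exp(−δ₀·dj Y)`.
QF-3 (◆, non-blocking; supplier-risk flag, HONEST): the letter is typed for EVERY `a₀ > 0` with no upper guard (and with a₀-FREE `c₀ γ₀ γ₁`) because the consumer's antecedent (`PortRecordLZdetHalf`) carries
only `0 < a₀` plus ⁸'s opaque tokens, while [15] Thm 1 ∕ Prop. 9 live at `a₀ ≤ ε₀`; NO claim is made here that (P2)(P4)(P5) hold a₀-uniformly for the defined `recordPreckLoc ∘ portVkAx` beyond `ε₀` — if the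
inhabitant (node00-def-Y's scheme) needs the small-field guard, the binder-compatible repair is to insert ⁸'s token(s) (`VariationalThm1RegSepCoP7MGB …`, `Gauge9RegSepTopStepGB …`, which the glue holds) as
hypotheses right after `0 < a₀ →` (◆'s slot «[QF-3(b)]») — an edition on ask, not a silent strengthening.  DISPLAYED — asserted for nothing; inhabited nowhere today.
[cite: Balaban1985Variational, Prop. 9 p.309, Thm 1 p.279, (117) p.295; Balaban1987RG1, (2.11)–(2.12) pp.267–268, (1.18) p.263, (1.21) p.264; Balaban1985UV3, (63) p.272, (25) p.262] -/
def P0HolExtAtRecord (F : T4Family) : Prop :=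
  ∃ c₀ γ₀ γ₁ : ℝ, 0 < c₀ ∧ 0 < γ₀ ∧ γ₀ ≤ γ₁ ∧
  ∀ δ₀ : ℝ, 0 < δ₀ → ∃ Mth : ℕ, ∀ Mc : ℕ, Mth ≤ Mc → McGuard F Mc →
  ∀ a₀ : ℝ, 0 < a₀ →
  ∃ α₀ α₁ : ℝ, 0 < α₀ ∧ 0 < α₁ ∧
  ∀ ε₂₉ : ℝ, 0 < ε₂₉ → ∀ k : ℕ,
    ∃ TC TY TZY AdM AdZ, P0CarrierClauses F a₀ δ₀ c₀ γ₀ γ₁ Mc α₀ α₁ ε₂₉ k TC TY TZY AdM AdZ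

end Summit.QuantumFields.YangMills.Theorems.K0RecordFormatNames

end
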